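import Summits.MatrixMultiplication.OmegaCensus.DicyclicSubFourP3Structure
import HarnessLib

/-!
# Partner counting in periodic tilings (tools for the P3 exclusion in dicyclic type)

ω-census, family (b3).  Framing: lottery ticket; floor = certified bounds/negative ranges.

Abstract lemmas about a finite abelian group `A` with a fixed `c₀` (`2c₀ = 0 ≠ c₀` where needed); the *partner* of
`z` is `z + c₀`, and a point `z ∈ Z` is *partner-less in `Z`* if `z + c₀ ∉ Z`.  They are the combinatorial core
of `DicyclicNoSubFourP3.lean` (no `law − 4` triple of shape P3 in dicyclic type).

* `card_filter_add_notMem_le`: a subset `Z` of a `c₀`-periodic set `E` has at most `|E \ Z|` partner-less points.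
* `card_partnerless_reflect`: for an injective sumset `X + Y` the number of partner-less points does not change when
  `X` is replaced by a reflected copy `a − X` (the solutions of `x + y + c₀ = x' + y'` correspond under
  `(x, y, x', y') ↦ (a − x', y, a − x, y')`).
* `periodic_tiling_defect` (**offset lemma**): if the injective sumset `Z = Q + D` lies in the tiling `W = P + D'`
  (`P` periodic, `P + D'` injective, `(P − P) ∩ (D − D) = {0}`, `|D| = |D'| ≥ 2`, `|P| = |Q| + 1`), then `Z` has at
  least two partner-less points.  Proof: the three points of a tile `q + D` lie in distinct classes `P + d'`, so each
  class contains exactly `|Q| = |P| − 1` points of `Z`; a point of `W` missing from `Z` together with its partner would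
  make its class miss two points; hence the partner of every missing point is a partner-less point of `Z`, and there
  are `|W| − |Z| = |D'| ≥ 2` missing points.
-/

namespace Summit.MatrixMultiplication.OmegaCensus

open Finset

section Abstract

variable {A : Type*} [AddCommGroup A] [DecidableEq A]

/-- A subset `Z` of a `c₀`-periodic set `E` has at most `|E \ Z|` partner-less points (`z ↦ z + c₀` injects them
into `E \ Z`). [folklore] -/
theorem card_filter_add_notMem_le {E Z : Finset A} {c₀ : A} (hE : ∀ e ∈ E, e + c₀ ∈ E) (hZE : Z ⊆ E) :
    (Z.filter fun z => z + c₀ ∉ Z).card ≤ (E \ Z).card := by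
  refine card_le_card_of_injOn (fun z => z + c₀) (fun z hz => ?_) (fun z₁ _ z₂ _ h => add_right_cancel h)
  have hz' := mem_filter.1 (mem_coe.1 hz)
  exact mem_coe.2 (mem_sdiff.2 ⟨hE _ (hZE hz'.1), hz'.2⟩)

/-- For an injective sumset `X + Y`, the partnered points `z` (`z + c₀ ∈ X + Y`) are in bijection with the solutions
of `x + y + c₀ = x' + y'`. [folklore] -/
theorem card_filter_add_mem_sumset {X Y : Finset A} (c₀ : A)
    (hXY : ∀ x ∈ X, ∀ x' ∈ X, ∀ y ∈ Y, ∀ y' ∈ Y, x + y = x' + y' → x = x' ∧ y = y') :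
    (((X ×ˢ Y).image fun p : A × A => p.1 + p.2).filter fun z =>
        z + c₀ ∈ (X ×ˢ Y).image fun p : A × A => p.1 + p.2).card =
      (((X ×ˢ Y) ×ˢ (X ×ˢ Y)).filter fun q : (A × A) × (A × A) =>
        q.1.1 + q.1.2 + c₀ = q.2.1 + q.2.2).card := by
  symm
  apply card_nbij (fun q : (A × A) × (A × A) => q.1.1 + q.1.2)
  · intro q hq
    obtain ⟨hq, heq⟩ := mem_filter.1 (mem_coe.1 hq)
    obtain ⟨h1, h2⟩ := mem_product.1 hq
    refine mem_coe.2 (mem_filter.2 ⟨mem_image.2 ⟨q.1, h1, rfl⟩, ?_⟩)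
    have e : q.1.1 + q.1.2 + c₀ = q.2.1 + q.2.2 := heq
    rw [e]
    exact mem_image.2 ⟨q.2, h2, rfl⟩
  · intro q₁ hq₁ q₂ hq₂ h
    obtain ⟨hm₁, e₁⟩ := mem_filter.1 (mem_coe.1 hq₁)
    obtain ⟨hm₂, e₂⟩ := mem_filter.1 (mem_coe.1 hq₂)
    obtain ⟨ha₁, hb₁⟩ := mem_product.1 hm₁
    obtain ⟨ha₂, hb₂⟩ := mem_product.1 hm₂
    obtain ⟨hx₁, hy₁⟩ := mem_product.1 ha₁
    obtain ⟨hx₁', hy₁'⟩ := mem_product.1 hb₁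
    obtain ⟨hx₂, hy₂⟩ := mem_product.1 ha₂
    obtain ⟨hx₂', hy₂'⟩ := mem_product.1 hb₂
    have h' : q₁.1.1 + q₁.1.2 = q₂.1.1 + q₂.1.2 := h
    obtain ⟨ea, eb⟩ := hXY _ hx₁ _ hx₂ _ hy₁ _ hy₂ h'
    have h'' : q₁.2.1 + q₁.2.2 = q₂.2.1 + q₂.2.2 := by rw [← e₁, ← e₂, h']
    obtain ⟨ec, ed⟩ := hXY _ hx₁' _ hx₂' _ hy₁' _ hy₂' h''
    exact Prod.ext (Prod.ext ea eb) (Prod.ext ec ed)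
  · intro z hz
    obtain ⟨hz, hzc⟩ := mem_filter.1 (mem_coe.1 hz)
    obtain ⟨xy, hxy, rfl⟩ := mem_image.1 hz
    obtain ⟨xy', hxy', he⟩ := mem_image.1 hzc
    exact ⟨(xy, xy'), mem_coe.2 (mem_filter.2 ⟨mem_product.2 ⟨hxy, hxy'⟩, he.symm⟩), rfl⟩

/-- The solutions of `x + y + c₀ = x' + y'` in `X × Y × X × Y` correspond to those in `(a − X) × Y × (a − X) × Y`
under `(x, y, x', y') ↦ (a − x', y, a − x, y')`. [folklore] -/
theorem card_addsol_reflect {X Y : Finset A} (c₀ a : A) :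
    (((X ×ˢ Y) ×ˢ (X ×ˢ Y)).filter fun q : (A × A) × (A × A) => q.1.1 + q.1.2 + c₀ = q.2.1 + q.2.2).card =
    ((((X.image fun x => a - x) ×ˢ Y) ×ˢ ((X.image fun x => a - x) ×ˢ Y)).filter
        fun q : (A × A) × (A × A) => q.1.1 + q.1.2 + c₀ = q.2.1 + q.2.2).card := by
  apply card_nbij' (fun q : (A × A) × (A × A) => ((a - q.2.1, q.1.2), (a - q.1.1, q.2.2)))
    (fun q : (A × A) × (A × A) => ((a - q.2.1, q.1.2), (a - q.1.1, q.2.2)))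
  · intro q hq
    obtain ⟨hm, e⟩ := mem_filter.1 (mem_coe.1 hq)
    obtain ⟨ha, hb⟩ := mem_product.1 hm
    obtain ⟨hx, hy⟩ := mem_product.1 ha
    obtain ⟨hx', hy'⟩ := mem_product.1 hb
    refine mem_coe.2 (mem_filter.2 ⟨mem_product.2 ⟨mem_product.2 ⟨mem_image_of_mem _ hx', hy⟩,
      mem_product.2 ⟨mem_image_of_mem _ hx, hy'⟩⟩, ?_⟩)
    have e' : q.1.1 + q.1.2 + c₀ = q.2.1 + q.2.2 := e
    show a - q.2.1 + q.1.2 + c₀ = a - q.1.1 + q.2.2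
    linear_combination (norm := abel1) e'
  · intro q hq
    obtain ⟨hm, e⟩ := mem_filter.1 (mem_coe.1 hq)
    obtain ⟨ha, hb⟩ := mem_product.1 hm
    obtain ⟨hx, hy⟩ := mem_product.1 ha
    obtain ⟨hx', hy'⟩ := mem_product.1 hb
    obtain ⟨x₀, hx₀, ex₀⟩ := mem_image.1 hx
    obtain ⟨x₁, hx₁, ex₁⟩ := mem_image.1 hx'
    refine mem_coe.2 (mem_filter.2 ⟨mem_product.2 ⟨mem_product.2 ⟨?_, hy⟩, mem_product.2 ⟨?_, hy'⟩⟩, ?_⟩)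
    · show a - q.2.1 ∈ X
      rw [← ex₁, sub_sub_cancel]; exact hx₁
    · show a - q.1.1 ∈ X
      rw [← ex₀, sub_sub_cancel]; exact hx₀
    · have e' : q.1.1 + q.1.2 + c₀ = q.2.1 + q.2.2 := e
      show a - q.2.1 + q.1.2 + c₀ = a - q.1.1 + q.2.2
      linear_combination (norm := abel1) e'
  · intro q _
    simp only [sub_sub_cancel, Prod.mk.eta]
  · intro q _
    simp only [sub_sub_cancel, Prod.mk.eta]

omit [DecidableEq A] in
/-- Pairwise injectivity of `X + Y` as `Set.InjOn`. [folklore] -/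
theorem sumset_injOn_of_pairs {X Y : Finset A}
    (hXY : ∀ x ∈ X, ∀ x' ∈ X, ∀ y ∈ Y, ∀ y' ∈ Y, x + y = x' + y' → x = x' ∧ y = y') :
    Set.InjOn (fun p : A × A => p.1 + p.2) ↑(X ×ˢ Y) := by
  rintro ⟨x, y⟩ hxy ⟨x', y'⟩ hxy' h
  obtain ⟨hx, hy⟩ := mem_product.1 (mem_coe.1 hxy)
  obtain ⟨hx', hy'⟩ := mem_product.1 (mem_coe.1 hxy')
  obtain ⟨e1, e2⟩ := hXY x hx x' hx' y hy y' hy' h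
  rw [e1, e2]

/-- **Partner-less points are reflection invariant.** For an injective sumset `X + Y` and the reflected copy
`(a − X) + Y`, the numbers of partner-less points agree. [folklore] -/
theorem card_partnerless_reflect {X Y : Finset A} (c₀ a : A)
    (hXY : ∀ x ∈ X, ∀ x' ∈ X, ∀ y ∈ Y, ∀ y' ∈ Y, x + y = x' + y' → x = x' ∧ y = y') :
    ((((X.image fun x => a - x) ×ˢ Y).image fun p : A × A => p.1 + p.2).filter fun z =>
        z + c₀ ∉ ((X.image fun x => a - x) ×ˢ Y).image fun p : A × A => p.1 + p.2).card =
      (((X ×ˢ Y).image fun p : A × A => p.1 + p.2).filter fun z =>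
        z + c₀ ∉ (X ×ˢ Y).image fun p : A × A => p.1 + p.2).card := by
  set X' := X.image fun x => a - x with hX'
  have hX'Y : ∀ x ∈ X', ∀ x' ∈ X', ∀ y ∈ Y, ∀ y' ∈ Y, x + y = x' + y' → x = x' ∧ y = y' := by
    intro x hx x' hx' y hy y' hy' h
    obtain ⟨x₀, hx₀, rfl⟩ := mem_image.1 hx
    obtain ⟨x₁, hx₁, rfl⟩ := mem_image.1 hx'
    obtain ⟨e1, e2⟩ := hXY x₁ hx₁ x₀ hx₀ y hy y' hy' (by linear_combination (norm := abel1) h)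
    exact ⟨by rw [e1], e2⟩
  have cX' : X'.card = X.card := card_image_of_injective _ fun x x' h => sub_right_injective h
  have cZ : ((X ×ˢ Y).image fun p : A × A => p.1 + p.2).card = X.card * Y.card := by
    rw [card_image_of_injOn (sumset_injOn_of_pairs hXY), card_product]
  have cZ' : ((X' ×ˢ Y).image fun p : A × A => p.1 + p.2).card = X.card * Y.card := by
    rw [card_image_of_injOn (sumset_injOn_of_pairs hX'Y), card_product, cX']
  have t := card_filter_add_card_filter_not (s := (X ×ˢ Y).image fun p : A × A => p.1 + p.2)
    (fun z => z + c₀ ∈ (X ×ˢ Y).image fun p : A × A => p.1 + p.2)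
  have t' := card_filter_add_card_filter_not (s := (X' ×ˢ Y).image fun p : A × A => p.1 + p.2)
    (fun z => z + c₀ ∈ (X' ×ˢ Y).image fun p : A × A => p.1 + p.2)
  have r := card_addsol_reflect (X := X) (Y := Y) c₀ a
  rw [← hX'] at r
  rw [card_filter_add_mem_sumset c₀ hXY, cZ] at t
  rw [card_filter_add_mem_sumset c₀ hX'Y, cZ', ← r] at t'
  omega

/-- **The offset lemma (periodic tiling defect).**  `2c₀ = 0 ≠ c₀`; `P` is `c₀`-periodic, `P + D'` and `Q + D`
are injective sumsets, `(P − P) ∩ (D − D) = {0}`, `Q + D ⊆ P + D'`, `|P| = |Q| + 1`, `|D| = |D'| ≥ 2`.  Then `Q + D`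
has at least two partner-less points. [folklore] -/
theorem periodic_tiling_defect {P Q D D' : Finset A} {c₀ : A} (hc₀ : c₀ ≠ 0) (h2c : c₀ + c₀ = 0)
    (hP : ∀ p ∈ P, p + c₀ ∈ P)
    (hPD' : ∀ p ∈ P, ∀ p' ∈ P, ∀ d ∈ D', ∀ d' ∈ D', p + d = p' + d' → p = p' ∧ d = d')
    (hPD : ∀ p ∈ P, ∀ p' ∈ P, ∀ d ∈ D, ∀ d' ∈ D, p + d = p' + d' → d = d')
    (hQD : ∀ q ∈ Q, ∀ q' ∈ Q, ∀ d ∈ D, ∀ d' ∈ D, q + d = q' + d' → q = q' ∧ d = d')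
    (hZW : ∀ q ∈ Q, ∀ d ∈ D, ∃ p ∈ P, ∃ d' ∈ D', p + d' = q + d)
    (hcard : P.card = Q.card + 1) (hD : D.card = D'.card) (hD2 : 2 ≤ D'.card) :
    2 ≤ (((Q ×ˢ D).image fun x : A × A => x.1 + x.2).filter
      fun z => z + c₀ ∉ (Q ×ˢ D).image fun x : A × A => x.1 + x.2).card := by
  set Z := (Q ×ˢ D).image fun x : A × A => x.1 + x.2 with hZ
  set Sg := Z.filter fun z => z + c₀ ∉ Z with hSg
  by_contra hlt
  push Not at hlt
  -- the tiling `W = P + D'` and a point `f ∈ W` missing from `Z` together with its partner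
  set W := (P ×ˢ D').image fun x : A × A => x.1 + x.2 with hW
  have cW : W.card = P.card * D'.card := by
    rw [hW, card_image_of_injOn (sumset_injOn_of_pairs hPD'), card_product]
  have cZ : Z.card ≤ Q.card * D.card := by
    rw [hZ, ← card_product]; exact card_image_le
  set Y := Z ∪ Sg.image (· + c₀) with hY
  have cY : Y.card < W.card := by
    have h1 : Y.card ≤ Z.card + (Sg.image (· + c₀)).card := card_union_le _ _
    have h2 : (Sg.image (· + c₀)).card ≤ Sg.card := card_image_le
    have h3 : W.card = Q.card * D.card + D'.card := by rw [cW, hcard, hD]; ring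
    omega
  obtain ⟨f, hfW, hfY⟩ := exists_mem_notMem_of_card_lt_card cY
  obtain ⟨pd₀, hpd₀, hf⟩ := mem_image.1 hfW
  obtain ⟨hp₀, hd₀⟩ := mem_product.1 hpd₀
  have hfZ : f ∉ Z := fun h => hfY (mem_union_left _ h)
  have hfcZ : f + c₀ ∉ Z := by
    intro h
    have hmem : f + c₀ ∈ Sg := mem_filter.2 ⟨h, by rwa [add_assoc, h2c, add_zero]⟩
    exact hfY (mem_union_right _ (mem_image.2 ⟨f + c₀, hmem, by rw [add_assoc, h2c, add_zero]⟩))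
  -- the incidence set `M = {((q,d),(p,d')) : q + d = p + d'}`
  set M := ((Q ×ˢ D) ×ˢ (P ×ˢ D')).filter fun m : (A × A) × (A × A) => m.1.1 + m.1.2 = m.2.1 + m.2.2
    with hM
  have cM : M.card = Q.card * D.card := by
    rw [← card_product]
    apply card_nbij (fun m : (A × A) × (A × A) => m.1)
    · intro m hm
      obtain ⟨hm, -⟩ := mem_filter.1 (mem_coe.1 hm)
      exact mem_coe.2 (mem_product.1 hm).1
    · intro m₁ hm₁ m₂ hm₂ h
      obtain ⟨hm₁, e₁⟩ := mem_filter.1 (mem_coe.1 hm₁)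
      obtain ⟨hm₂, e₂⟩ := mem_filter.1 (mem_coe.1 hm₂)
      obtain ⟨hp₁, hd₁⟩ := mem_product.1 (mem_product.1 hm₁).2
      obtain ⟨hp₂, hd₂⟩ := mem_product.1 (mem_product.1 hm₂).2
      have h' : m₁.1 = m₂.1 := h
      have h'' : m₁.2.1 + m₁.2.2 = m₂.2.1 + m₂.2.2 := by rw [← e₁, ← e₂, h']
      obtain ⟨ea, eb⟩ := hPD' _ hp₁ _ hp₂ _ hd₁ _ hd₂ h''
      exact Prod.ext h' (Prod.ext ea eb)
    · intro qd hqd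
      obtain ⟨hq, hd⟩ := mem_product.1 (mem_coe.1 hqd)
      obtain ⟨p, hp, d', hd', he⟩ := hZW _ hq _ hd
      exact ⟨(qd, (p, d')), mem_coe.2 (mem_filter.2 ⟨mem_product.2 ⟨mem_coe.1 hqd, mem_product.2 ⟨hp, hd'⟩⟩,
        he.symm⟩), rfl⟩
  -- fibres over the class `d' ∈ D'`
  have fib := card_eq_sum_card_fiberwise (s := M) (t := D') (f := fun m : (A × A) × (A × A) => m.2.2)
    (fun m hm => by
      obtain ⟨hm, -⟩ := mem_filter.1 (mem_coe.1 hm)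
      exact mem_coe.2 (mem_product.1 (mem_product.1 hm).2).2)
  have fle : ∀ d' ∈ D', (M.filter fun m : (A × A) × (A × A) => m.2.2 = d').card ≤ Q.card := by
    intro d' hd'
    refine card_le_card_of_injOn (fun m : (A × A) × (A × A) => m.1.1) (fun m hm => ?_) ?_
    · obtain ⟨hm, -⟩ := mem_filter.1 (mem_coe.1 hm)
      obtain ⟨hm, -⟩ := mem_filter.1 hm
      exact mem_coe.2 (mem_product.1 (mem_product.1 hm).1).1
    · intro m₁ hm₁ m₂ hm₂ h
      obtain ⟨hm₁, f₁⟩ := mem_filter.1 (mem_coe.1 hm₁)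
      obtain ⟨hm₁, e₁⟩ := mem_filter.1 hm₁
      obtain ⟨hm₂, f₂⟩ := mem_filter.1 (mem_coe.1 hm₂)
      obtain ⟨hm₂, e₂⟩ := mem_filter.1 hm₂
      obtain ⟨hqd₁, hpd₁⟩ := mem_product.1 hm₁
      obtain ⟨hqd₂, hpd₂⟩ := mem_product.1 hm₂
      obtain ⟨hq₁, hd₁⟩ := mem_product.1 hqd₁
      obtain ⟨hq₂, hd₂⟩ := mem_product.1 hqd₂
      obtain ⟨hp₁, hd₁'⟩ := mem_product.1 hpd₁
      obtain ⟨hp₂, hd₂'⟩ := mem_product.1 hpd₂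
      have h' : m₁.1.1 = m₂.1.1 := h
      have key : m₁.2.1 + m₂.1.2 = m₂.2.1 + m₁.1.2 := by
        linear_combination (norm := abel1) e₂ - e₁ + h' - f₁ + f₂
      have ed : m₂.1.2 = m₁.1.2 := hPD _ hp₁ _ hp₂ _ hd₂ _ hd₁ key
      have e1 : m₁.1 = m₂.1 := Prod.ext h' ed.symm
      have h'' : m₁.2.1 + m₁.2.2 = m₂.2.1 + m₂.2.2 := by rw [← e₁, ← e₂, e1]
      obtain ⟨ea, eb⟩ := hPD' _ hp₁ _ hp₂ _ hd₁' _ hd₂' h''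
      exact Prod.ext e1 (Prod.ext ea eb)
  -- every fibre has exactly `|Q|` elements; in particular the fibre of `d₀ = pd₀.2`
  have fge : Q.card ≤ (M.filter fun m : (A × A) × (A × A) => m.2.2 = pd₀.2).card := by
    by_contra hlt'
    push Not at hlt'
    have hsum : ∑ d' ∈ D', (M.filter fun m : (A × A) × (A × A) => m.2.2 = d').card < ∑ d' ∈ D', Q.card :=
      sum_lt_sum fle ⟨pd₀.2, hd₀, hlt'⟩
    rw [← fib, cM, sum_const, smul_eq_mul, hD, mul_comm] at hsum
    exact lt_irrefl _ hsum
  -- but that fibre injects into `P` minus the two points `pd₀.1`, `pd₀.1 + c₀`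
  have hp₀c : pd₀.1 + c₀ ∈ P := hP _ hp₀
  have hne : pd₀.1 + c₀ ≠ pd₀.1 := fun h => hc₀ (by simpa using h)
  have cP2 : ((P.erase pd₀.1).erase (pd₀.1 + c₀)).card + 2 = P.card := by
    rw [card_erase_of_mem (mem_erase.2 ⟨hne, hp₀c⟩), card_erase_of_mem hp₀]
    have := card_pos.2 ⟨_, hp₀⟩
    have h2 : 2 ≤ P.card := by
      have := card_le_card (show ({pd₀.1, pd₀.1 + c₀} : Finset A) ⊆ P by
        intro x hx
        rcases mem_insert.1 hx with rfl | hx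
        · exact hp₀
        · rw [mem_singleton.1 hx]; exact hp₀c)
      rwa [card_pair hne.symm] at this
    omega
  have fle₀ : (M.filter fun m : (A × A) × (A × A) => m.2.2 = pd₀.2).card ≤
      ((P.erase pd₀.1).erase (pd₀.1 + c₀)).card := by
    refine card_le_card_of_injOn (fun m : (A × A) × (A × A) => m.2.1) (fun m hm => ?_) ?_
    · obtain ⟨hm, f₁⟩ := mem_filter.1 (mem_coe.1 hm)
      obtain ⟨hm, e₁⟩ := mem_filter.1 hm
      obtain ⟨hqd, hpd⟩ := mem_product.1 hm
      obtain ⟨hp, -⟩ := mem_product.1 hpd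
      have hz : m.2.1 + m.2.2 ∈ Z := by rw [← e₁]; exact mem_image.2 ⟨m.1, hqd, rfl⟩
      rw [f₁] at hz
      refine mem_coe.2 (mem_erase.2 ⟨fun h => hfcZ ?_, mem_erase.2 ⟨fun h => hfZ ?_, hp⟩⟩)
      · rw [← hf, show pd₀.1 + pd₀.2 + c₀ = pd₀.1 + c₀ + pd₀.2 by abel, ← h]; exact hz
      · rw [← hf, ← h]; exact hz
    · intro m₁ hm₁ m₂ hm₂ h
      obtain ⟨hm₁, f₁⟩ := mem_filter.1 (mem_coe.1 hm₁)
      obtain ⟨hm₁, e₁⟩ := mem_filter.1 hm₁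
      obtain ⟨hm₂, f₂⟩ := mem_filter.1 (mem_coe.1 hm₂)
      obtain ⟨hm₂, e₂⟩ := mem_filter.1 hm₂
      obtain ⟨hqd₁, -⟩ := mem_product.1 hm₁
      obtain ⟨hqd₂, -⟩ := mem_product.1 hm₂
      obtain ⟨hq₁, hd₁⟩ := mem_product.1 hqd₁
      obtain ⟨hq₂, hd₂⟩ := mem_product.1 hqd₂
      have h' : m₁.2.1 = m₂.2.1 := h
      have e2 : m₁.2 = m₂.2 := Prod.ext h' (f₁.trans f₂.symm)
      have h'' : m₁.1.1 + m₁.1.2 = m₂.1.1 + m₂.1.2 := by rw [e₁, e₂, e2]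
      obtain ⟨ea, eb⟩ := hQD _ hq₁ _ hq₂ _ hd₁ _ hd₂ h''
      exact Prod.ext (Prod.ext ea eb) e2
  omega

end Abstract

end Summit.MatrixMultiplication.OmegaCensus
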